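import Summits.RiemannHypothesis.RiemannHypothesis.Theorems.SemilocalPolyIncrement
import HarnessLib

/-!
# Semi-local thresholds, negative side (IVb): PIECEWISE polynomial Markov witnesses (the kinked class), part 1 — the witness,
  its Markov property and its norm

Cell `rh-explicit` (HOME `run/shared/lean/pub/rh-explicit/`), seat cc-s2-4 gen8 (kernel column of the A4 SEMILOCAL-TABLE; second file of
the PIECEWISE-witness layer of `HOME/cc-s2-4/CC4-LEAN.md` §13.6).  Honest framing: bookkeeping for negative certificates about the tree's
`weilSemilocalThreshold S`; nothing here bears on RH.  No data is trusted.

WHY (numbers, `HOME/cc-s2-4/gen8/KNEE-NOTE.md`): the near-extremal functions of the `S_q` forms have slope breaks at the atom images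
`x = |b − log n|` (cc-s2-6, cc6-hp); global odd polynomials of kernel-feasible degree see no negative direction closer than
`a* + 0.008 … 0.016`, while odd PIECEWISE polynomials of degree `≤ 7` with those breakpoints are negative from `a* + 0.004`
(`{2,3}`: `−1.2e-5` at `0.8105`; `S_13`: `−2.5e-3` at `1.288`).  This file types the witness class:

* `Pw` = a piece `(lo, hi, p)`; `pwF P x = Σ_k 1_{[lo_k, hi_k]}(x)·p_k(x)` (pieces inside `[0, b]`), the witness
  `pwG P x = pwF P x − pwF P (−x)` (EXACTLY odd by construction) and `pwWitness P = (pwG P : ℂ)`;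
* `isMarkovWitness_pwWitness`: for `pwInside b P` (all `0 ≤ lo_k ≤ hi_k ≤ b`) the witness is a Markov witness on `[−b, b]` with the
  bound `2·pwAbsBound P` (finitely many jumps are a.e.-continuity);
* `integral_norm_sq_pwWitness`: `∫ ‖G‖² = 2·pwNormSqF P` (a rational) when the pieces' interiors are pairwise disjoint (`pwDisjoint`).

The increment identity on `t`-pieces and the certificate are parts 2–3 (`SemilocalPiecewiseIncrement/Cert`).  Folklore throughout.
-/

set_option autoImplicit false
set_option linter.dupNamespace false  -- the mandated namespace repeats `RiemannHypothesis`

noncomputable section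

open Complex Filter Set MeasureTheory Topology
open scoped Real

namespace Summit.RiemannHypothesis.RiemannHypothesis.Theorems.SemilocalPolyWitness

open MeasureTheory Set Finset Real
open Literature.NumberTheory.LFunctions
open Summit.RiemannHypothesis.RiemannHypothesis.Theorems.MotivicDoor
open LQ

/-! ## The piecewise witness -/

/-- One piece: the polynomial `p` (coefficients in powers of `x`) on the closed interval `[lo, hi]`. -/
structure Pw where
  /-- left end -/
  lo : ℚ
  /-- right end -/
  hi : ℚ
  /-- the polynomial on the piece -/
  p : List ℚ

/-- `F(x) = Σ_k 1_{[lo_k, hi_k]}(x)·p_k(x)`. -/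
def pwF : List Pw → ℝ → ℝ
  | [], _ => 0
  | pc :: P, x => (Icc (pc.lo : ℝ) pc.hi).indicator (ev pc.p) x + pwF P x

/-- The odd witness `G(x) = F(x) − F(−x)`. -/
def pwG (P : List Pw) (x : ℝ) : ℝ := pwF P x - pwF P (-x)

/-- The witness as a complex-valued function. -/
def pwWitness (P : List Pw) (x : ℝ) : ℂ := (pwG P x : ℂ)

/-- All pieces lie in `[0, b]`: `0 ≤ lo_k ≤ hi_k ≤ b`. -/
def pwInside (b : ℚ) : List Pw → Bool
  | [] => true
  | pc :: P => decide (0 ≤ pc.lo) && decide (pc.lo ≤ pc.hi) && decide (pc.hi ≤ b) && pwInside b P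

/-- A bound of `|F|`: `Σ_k absBound p_k hi_k`. -/
def pwAbsBound : List Pw → ℚ
  | [] => 0
  | pc :: P => absBound pc.p pc.hi + pwAbsBound P

/-- The interiors are pairwise disjoint: each piece ends before every later piece starts or starts after it ends. -/
def pwDisjoint : List Pw → Bool
  | [] => true
  | pc :: P => P.all (fun qc ↦ decide (pc.hi ≤ qc.lo) || decide (qc.hi ≤ pc.lo)) && pwDisjoint P

/-- `∫ F² = Σ_k [∫ p_k²]_{lo_k}^{hi_k}` as a rational. -/
def pwNormSqF : List Pw → ℚ
  | [] => 0
  | pc :: P => (evQ (integ (mul pc.p pc.p)) pc.hi - evQ (integ (mul pc.p pc.p)) pc.lo) + pwNormSqF P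

/-! ## Elementary properties of `F` -/

/-- `G` is odd. -/
theorem pwG_neg (P : List Pw) (x : ℝ) : pwG P (-x) = -pwG P x := by
  simp only [pwG, neg_neg]; ring

/-- `F` is measurable. -/
theorem measurable_pwF : ∀ P : List Pw, Measurable (pwF P)
  | [] => measurable_const
  | pc :: P => ((continuous_ev pc.p).measurable.indicator measurableSet_Icc).add (measurable_pwF P)

/-- `pwInside` unfolded. -/
theorem pwInside_cons {b : ℚ} {pc : Pw} {P : List Pw} (h : pwInside b (pc :: P) = true) :
    0 ≤ pc.lo ∧ pc.lo ≤ pc.hi ∧ pc.hi ≤ b ∧ pwInside b P = true := by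
  simp only [pwInside, Bool.and_eq_true, decide_eq_true_eq] at h
  exact ⟨h.1.1.1, h.1.1.2, h.1.2, h.2⟩

/-- `pwAbsBound ≥ 0`. -/
theorem pwAbsBound_nonneg {b : ℚ} : ∀ {P : List Pw}, pwInside b P = true → 0 ≤ pwAbsBound P
  | [], _ => le_rfl
  | pc :: P, h => by
      obtain ⟨h0, hlh, _, hP⟩ := pwInside_cons h
      have := pwAbsBound_nonneg hP
      have := absBound_nonneg pc.p (h0.trans hlh)
      simp only [pwAbsBound]; positivity

/-- `|F x| ≤ pwAbsBound P`. -/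
theorem abs_pwF_le {b : ℚ} : ∀ {P : List Pw}, pwInside b P = true → ∀ x : ℝ, |pwF P x| ≤ (pwAbsBound P : ℝ)
  | [], _, x => by simp [pwF, pwAbsBound]
  | pc :: P, h, x => by
      obtain ⟨h0, hlh, _, hP⟩ := pwInside_cons h
      have ih := abs_pwF_le hP x
      simp only [pwF, pwAbsBound]
      push_cast
      refine (abs_add_le _ _).trans (add_le_add ?_ ih)
      by_cases hx : x ∈ Icc (pc.lo : ℝ) pc.hi
      · rw [indicator_of_mem hx]
        have hxabs : |x| ≤ pc.hi := by
          have h0' : (0 : ℝ) ≤ pc.lo := by exact_mod_cast h0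
          rw [abs_of_nonneg (h0'.trans hx.1)]; exact hx.2
        exact abs_ev_le_absBound pc.p hxabs
      · rw [indicator_of_notMem hx, abs_zero]
        exact_mod_cast absBound_nonneg pc.p (h0.trans hlh)

/-- `F x = 0` off `[0, b]`. -/
theorem pwF_eq_zero {b : ℚ} : ∀ {P : List Pw}, pwInside b P = true → ∀ {x : ℝ}, (x < 0 ∨ (b : ℝ) < x) → pwF P x = 0
  | [], _, _, _ => rfl
  | pc :: P, h, x, hx => by
      obtain ⟨h0, _, hb, hP⟩ := pwInside_cons h
      simp only [pwF, pwF_eq_zero hP hx, add_zero]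
      refine indicator_of_notMem (fun hm ↦ ?_) _
      have h0' : (0 : ℝ) ≤ pc.lo := by exact_mod_cast h0
      have hb' : (pc.hi : ℝ) ≤ b := by exact_mod_cast hb
      rcases hx with hx | hx
      · linarith [hm.1]
      · linarith [hm.2]

/-- The indicator of a closed interval times a continuous function is continuous away from the two endpoints. -/
theorem continuousAt_indicator_Icc {f : ℝ → ℝ} (hf : Continuous f) {lo hi x : ℝ} (hlo : x ≠ lo) (hhi : x ≠ hi) :
    ContinuousAt ((Icc lo hi).indicator f) x := by
  by_cases h : x ∈ Ioo lo hi
  · have hev : f =ᶠ[𝓝 x] (Icc lo hi).indicator f := by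
      filter_upwards [Ioo_mem_nhds h.1 h.2] with y hy
      rw [indicator_of_mem (Ioo_subset_Icc_self hy)]
    exact hf.continuousAt.congr hev
  · have hout : x ∉ Icc lo hi := fun hm ↦ h ⟨lt_of_le_of_ne hm.1 (Ne.symm hlo), lt_of_le_of_ne hm.2 hhi⟩
    have hev : (fun _ ↦ (0 : ℝ)) =ᶠ[𝓝 x] (Icc lo hi).indicator f := by
      filter_upwards [isClosed_Icc.isOpen_compl.mem_nhds hout] with y hy
      rw [indicator_of_notMem hy]
    exact continuousAt_const.congr hev

/-- The finite set of endpoints of the pieces. -/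
def pwEnds : List Pw → Finset ℝ
  | [] => ∅
  | pc :: P => insert (pc.lo : ℝ) (insert (pc.hi : ℝ) (pwEnds P))

/-- `F` is continuous away from the endpoints. -/
theorem continuousAt_pwF : ∀ (P : List Pw) {x : ℝ}, x ∉ pwEnds P → ContinuousAt (pwF P) x
  | [], _, _ => continuousAt_const
  | pc :: P, x, hx => by
      simp only [pwEnds, Finset.mem_insert, not_or] at hx
      have h1 := continuousAt_indicator_Icc (continuous_ev pc.p) hx.1 hx.2.1
      have h2 := continuousAt_pwF P hx.2.2
      exact h1.add h2

/-- `G` is continuous away from `± endpoints`. -/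
theorem continuousAt_pwG (P : List Pw) {x : ℝ} (hx : x ∉ pwEnds P) (hx' : -x ∉ pwEnds P) : ContinuousAt (pwG P) x := by
  unfold pwG
  exact (continuousAt_pwF P hx).sub ((continuousAt_pwF P hx').comp (f := fun y : ℝ ↦ -y) continuous_neg.continuousAt)

/-- **A piecewise polynomial inside `[0, b]` gives a Markov witness on `[−b, b]`** (bound `2·pwAbsBound P`). -/
theorem isMarkovWitness_pwWitness {P : List Pw} {b : ℚ} (h : pwInside b P = true) (hb : 0 < b) :
    SemilocalMarkov.IsMarkovWitness (pwWitness P) b (2 * pwAbsBound P) := by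
  have hb' : (0 : ℝ) < b := by exact_mod_cast hb
  refine SemilocalMarkov.IsMarkovWitness.intro ?_ (fun x ↦ ?_) (fun x hx ↦ ?_) (fun x ↦ ?_) ?_ hb'
  · exact Complex.measurable_ofReal.comp ((measurable_pwF P).sub ((measurable_pwF P).comp measurable_neg))
  · rw [pwWitness, Complex.norm_real, Real.norm_eq_abs, pwG]
    have h1 := abs_pwF_le h x
    have h2 := abs_pwF_le h (-x)
    calc |pwF P x - pwF P (-x)| ≤ |pwF P x| + |pwF P (-x)| := abs_sub _ _
      _ ≤ pwAbsBound P + pwAbsBound P := add_le_add h1 h2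
      _ = 2 * (pwAbsBound P : ℝ) := by ring
  · have hx' : x < -(b : ℝ) ∨ (b : ℝ) < x := by
      rcases le_or_gt 0 x with h0 | h0
      · right; rwa [abs_of_nonneg h0] at hx
      · left; rw [abs_of_neg h0] at hx; linarith
    have e1 : pwF P x = 0 := pwF_eq_zero h (by rcases hx' with h' | h' <;> [left; right] <;> linarith)
    have e2 : pwF P (-x) = 0 := pwF_eq_zero h (by rcases hx' with h' | h' <;> [right; left] <;> linarith)
    simp [pwWitness, pwG, e1, e2]
  · simp [pwWitness, pwG_neg]
  · -- a.e. continuity: off the finite set `pwEnds ∪ −pwEnds`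
    set E : Set ℝ := (↑(pwEnds P) : Set ℝ) ∪ (fun y : ℝ ↦ -y) ⁻¹' ↑(pwEnds P) with hE
    have hEfin : E.Finite := (pwEnds P).finite_toSet.union ((pwEnds P).finite_toSet.preimage neg_injective.injOn)
    have h0 : volume E = 0 := hEfin.measure_zero volume
    refine (measure_eq_zero_iff_ae_notMem.1 h0).mono fun x hx ↦ ?_
    rw [hE, Set.mem_union, not_or] at hx
    have hc := continuousAt_pwG P (x := x) (by exact_mod_cast hx.1) (by simpa using hx.2)
    exact (Complex.continuous_ofReal.continuousAt).comp hc

/-! ## The norm `‖G‖² = 2·Σ_k ∫ p_k²` -/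

/-- `x ↦ F(x)²` is integrable. -/
theorem integrable_pwF_sq {P : List Pw} {b : ℚ} (h : pwInside b P = true) : Integrable fun x ↦ pwF P x ^ 2 := by
  refine SemilocalMarkov.integrable_of_norm_le_of_eq_zero (C := (pwAbsBound P : ℝ) ^ 2) (R := b)
    ((measurable_pwF P).pow_const 2).aestronglyMeasurable (fun x ↦ ?_) (fun x hx ↦ ?_)
  · rw [Real.norm_eq_abs, abs_pow, sq_abs, ← sq_abs]
    exact pow_le_pow_left₀ (abs_nonneg _) (abs_pwF_le h x) 2
  · have hx' : x < 0 ∨ (b : ℝ) < x := by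
      rcases le_or_gt 0 x with h0 | h0
      · right; rwa [abs_of_nonneg h0] at hx
      · left; exact h0
    rw [pwF_eq_zero h hx']; ring

/-- One piece: `∫ (1_{[lo,hi]}·p)² = [∫ p²]_{lo}^{hi}`. -/
theorem integral_indicator_sq (pc : Pw) (hlh : pc.lo ≤ pc.hi) :
    ∫ x, ((Icc (pc.lo : ℝ) pc.hi).indicator (ev pc.p) x) ^ 2 =
      ((evQ (integ (mul pc.p pc.p)) pc.hi - evQ (integ (mul pc.p pc.p)) pc.lo : ℚ) : ℝ) := by
  have e : (fun x ↦ ((Icc (pc.lo : ℝ) pc.hi).indicator (ev pc.p) x) ^ 2) =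
      (Icc (pc.lo : ℝ) pc.hi).indicator (fun x ↦ ev (mul pc.p pc.p) x) := by
    funext x
    by_cases hx : x ∈ Icc (pc.lo : ℝ) pc.hi
    · rw [indicator_of_mem hx, indicator_of_mem hx, ev_mul, sq]
    · rw [indicator_of_notMem hx, indicator_of_notMem hx]; ring
  rw [e, integral_indicator measurableSet_Icc, integral_Icc_eq_integral_Ioc,
    ← intervalIntegral.integral_of_le (by exact_mod_cast hlh), integral_ev]
  push_cast
  rw [ev_ratCast, ev_ratCast]

/-- Off the endpoints, at most one piece is active when the interiors are disjoint: the cross terms vanish. -/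
theorem indicator_mul_pwF_eq_zero {pc : Pw} :
    ∀ {P : List Pw}, (P.all (fun qc ↦ decide (pc.hi ≤ qc.lo) || decide (qc.hi ≤ pc.lo))) = true →
      ∀ {x : ℝ}, x ∉ pwEnds (pc :: P) → (Icc (pc.lo : ℝ) pc.hi).indicator (ev pc.p) x * pwF P x = 0
  | [], _, x, _ => by simp [pwF]
  | qc :: P, hall, x, hx => by
      simp only [List.all_cons, Bool.and_eq_true, Bool.or_eq_true, decide_eq_true_eq] at hall
      have hx' : x ∉ pwEnds (pc :: P) := by
        simp only [pwEnds, Finset.mem_insert, not_or] at hx ⊢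
        exact ⟨hx.1, hx.2.1, hx.2.2.2.2⟩
      have ih := indicator_mul_pwF_eq_zero hall.2 hx'
      simp only [pwF, mul_add, ih, add_zero]
      by_cases h1 : x ∈ Icc (pc.lo : ℝ) pc.hi
      · by_cases h2 : x ∈ Icc (qc.lo : ℝ) qc.hi
        · -- both active: x would be a shared endpoint
          exfalso
          simp only [pwEnds, Finset.mem_insert, not_or] at hx
          rcases hall.1 with hle | hle
          · have : (pc.hi : ℝ) ≤ qc.lo := by exact_mod_cast hle
            exact hx.2.1 (le_antisymm h1.2 (this.trans h2.1))
          · have : (qc.hi : ℝ) ≤ pc.lo := by exact_mod_cast hle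
            exact hx.1 (le_antisymm (h2.2.trans this) h1.1)
        · rw [indicator_of_notMem h2, mul_zero]
      · rw [indicator_of_notMem h1, zero_mul]

/-- `∫ F² = pwNormSqF P` when the pieces lie in `[0, b]` and their interiors are pairwise disjoint. -/
theorem integral_pwF_sq {b : ℚ} : ∀ {P : List Pw}, pwInside b P = true → pwDisjoint P = true →
    ∫ x, pwF P x ^ 2 = (pwNormSqF P : ℝ)
  | [], _, _ => by simp [pwF, pwNormSqF]
  | pc :: P, h, hd => by
      obtain ⟨h0, hlh, hb, hP⟩ := pwInside_cons h
      simp only [pwDisjoint, Bool.and_eq_true] at hd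
      obtain ⟨hall, hdP⟩ := hd
      have ih := integral_pwF_sq hP hdP
      set I : ℝ → ℝ := (Icc (pc.lo : ℝ) pc.hi).indicator (ev pc.p) with hI
      have hIi : Integrable fun x ↦ I x ^ 2 := by
        have := integrable_pwF_sq (P := [pc]) (b := b) (by simp [pwInside, h0, hlh, hb])
        simpa [pwF, hI] using this
      have hPi : Integrable fun x ↦ pwF P x ^ 2 := integrable_pwF_sq hP
      have hcross : (fun x ↦ 2 * (I x * pwF P x)) =ᵐ[volume] fun _ ↦ (0 : ℝ) := by
        have h0m : volume (↑(pwEnds (pc :: P)) : Set ℝ) = 0 := (pwEnds (pc :: P)).finite_toSet.measure_zero volume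
        refine (measure_eq_zero_iff_ae_notMem.1 h0m).mono fun x hx ↦ ?_
        show 2 * (I x * pwF P x) = 0
        rw [hI, indicator_mul_pwF_eq_zero hall (by exact_mod_cast hx), mul_zero]
      have hCi : Integrable fun x ↦ 2 * (I x * pwF P x) := (integrable_zero ℝ ℝ volume).congr hcross.symm
      have e : (fun x ↦ pwF (pc :: P) x ^ 2) = fun x ↦ (I x ^ 2 + pwF P x ^ 2) + 2 * (I x * pwF P x) := by
        funext x; simp only [pwF, hI]; ring
      have h12 : Integrable (fun x ↦ I x ^ 2 + pwF P x ^ 2) := hIi.add hPi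
      rw [e, integral_add h12 hCi, integral_add hIi hPi, integral_congr_ae hcross, integral_const, smul_zero,
        add_zero, ih, hI, integral_indicator_sq pc hlh, pwNormSqF]
      push_cast; ring

/-- `F(x)·F(−x) = 0` for `x ≠ 0` (the supports `[0,b]` and `[−b,0]` meet only at `0`). -/
theorem pwF_mul_pwF_neg {b : ℚ} {P : List Pw} (h : pwInside b P = true) {x : ℝ} (hx : x ≠ 0) :
    pwF P x * pwF P (-x) = 0 := by
  rcases lt_or_gt_of_ne hx with hlt | hgt
  · rw [pwF_eq_zero h (Or.inl hlt), zero_mul]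
  · rw [pwF_eq_zero h (x := -x) (Or.inl (by linarith)), mul_zero]

/-- **`‖G‖² = 2·pwNormSqF P`.** -/
theorem integral_norm_sq_pwWitness {b : ℚ} {P : List Pw} (h : pwInside b P = true) (hd : pwDisjoint P = true) :
    ∫ x, ‖pwWitness P x‖ ^ 2 = 2 * (pwNormSqF P : ℝ) := by
  have e : ∀ x, ‖pwWitness P x‖ ^ 2 = (pwF P x ^ 2 + pwF P (-x) ^ 2) + (-2) * (pwF P x * pwF P (-x)) := fun x ↦ by
    rw [pwWitness, Complex.norm_real, Real.norm_eq_abs, sq_abs, pwG]; ring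
  simp_rw [e]
  have h1 : Integrable fun x ↦ pwF P x ^ 2 := integrable_pwF_sq h
  have h2 : Integrable fun x ↦ pwF P (-x) ^ 2 := h1.comp_neg
  have hcross : (fun x ↦ (-2) * (pwF P x * pwF P (-x))) =ᵐ[volume] fun _ ↦ (0 : ℝ) := by
    have h0m : volume ({(0 : ℝ)} : Set ℝ) = 0 := measure_singleton 0
    refine (measure_eq_zero_iff_ae_notMem.1 h0m).mono fun x hx ↦ ?_
    show (-2) * (pwF P x * pwF P (-x)) = 0
    rw [pwF_mul_pwF_neg h (by simpa using hx), mul_zero]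
  have hCi : Integrable fun x ↦ (-2) * (pwF P x * pwF P (-x)) := (integrable_zero ℝ ℝ volume).congr hcross.symm
  have h12 : Integrable (fun x ↦ pwF P x ^ 2 + pwF P (-x) ^ 2) := h1.add h2
  rw [integral_add h12 hCi, integral_add h1 h2, integral_congr_ae hcross, integral_const, smul_zero, add_zero,
    integral_neg_eq_self (fun x ↦ pwF P x ^ 2) volume, integral_pwF_sq h hd]
  ring

end Summit.RiemannHypothesis.RiemannHypothesis.Theorems.SemilocalPolyWitness

end
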